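import Summits.Ventures.PercRepro.S2NineCaps
import Summits.Ventures.PercRepro.S2TailCell
import Summits.Ventures.PercRepro.S2DichotomyTools
import Summits.Ventures.PercRepro.S2CoindepCount
import Summits.Ventures.PercRepro.S2SpanningCount

/-!
# PercRepro — S2: THE CASE `ν = 8` OF THE COLOOP-FREE CELL `(13, 9)` (p7, gen 19; sub-claim S2; the row `p = 13`)

The case `ν = 8 = d − 1` (a set of nullity `8` on `≤ 14` points) by the kit's hitting counts against the kit's tail at `(13, 9)` on the caps
`16 / 121 / 842` (its rank part is exactly `6668014649413 / 23836050`): `#U ≤ 112970`, `#spanning ≤ 118201`, `m = 98`, ratio `0.82` —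
**`c025_thirteen_nine_cf_nu_eight`**. Nothing about the cell is claimed. Axioms: standard.
-/

open scoped Matroid

namespace PercRepro

namespace ThmN

open Set

variable {α : Type}

/-- The tail side of the cell `(13, 9)` on the caps `16 / 121 / 842` with the spanning count `S` a parameter: the rank-`≤ 5` part
of the kit's tail is exactly `6668014649413 / 23836050`. -/
theorem tail_thirteen_nine_cf (S m : ℕ) (h : (1024 : ℚ) * ((6668014649413 / 23836050 : ℚ) + (S : ℚ)) ≤ (m : ℚ) * 2 ^ 22) :
    1024 * ((((13 + 9).choose 4 : ℚ) +
      (∑ j ∈ Finset.range 6, (Nat.choose (min 5 ((9 + 3) / 2 + 1 - 2)) j : ℚ) / (((j + 1) + 3 * (j + 1).choose 2 + 3 * (j + 1).choose 3 + 2 * (j + 1).choose 4 : ℕ) : ℚ)) *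
        ((16 * (13 + 9 - 3).choose 2 + 121 * (13 + 9 - 4) + 842 : ℕ) : ℚ) +
      ((∑ j ∈ Finset.range 6, (Nat.choose 5 j : ℚ) / (((j + 1) + 3 * (j + 1).choose 2 + 3 * (j + 1).choose 3 + 2 * (j + 1).choose 4 : ℕ) : ℚ)) -
        (∑ j ∈ Finset.range 6, (Nat.choose (min 5 ((9 + 3) / 2 + 1 - 2)) j : ℚ) / (((j + 1) + 3 * (j + 1).choose 2 + 3 * (j + 1).choose 3 + 2 * (j + 1).choose 4 : ℕ) : ℚ))) *
        ((10 : ℕ).choose 5 : ℚ)) +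
      (((13 + 9).choose 3 * 2 ^ 3 + (13 + 9).choose 2 * 2 + (13 + 9) + 1 : ℕ) : ℚ) +
      (((13 + 9).choose 5 : ℚ) + (∑ j ∈ Finset.range (9), (Nat.choose (min 13 ((9 + 6) / 2 + 1 - 2)) j : ℚ) / (((j + 1) + 3 * (j + 1).choose 2 + 3 * (j + 1).choose 3 + 2 * (j + 1).choose 4 : ℕ) : ℚ)) * ((16 * (13 + 9 - 3).choose 3 + 121 * (13 + 9 - 4).choose 2 + 842 * (13 + 9 - 5) + (9 + 5).choose 6 : ℕ) : ℚ) +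
        ((∑ j ∈ Finset.range (9), (Nat.choose (min 19 (5 + 9) - 6) j : ℚ) / (((j + 1) + 3 * (j + 1).choose 2 + 3 * (j + 1).choose 3 + 2 * (j + 1).choose 4 : ℕ) : ℚ)) - (∑ j ∈ Finset.range (9), (Nat.choose (min 13 ((9 + 6) / 2 + 1 - 2)) j : ℚ) / (((j + 1) + 3 * (j + 1).choose 2 + 3 * (j + 1).choose 3 + 2 * (j + 1).choose 4 : ℕ) : ℚ))) *
        ((min 19 (5 + 9)).choose 6 : ℚ)) +
      (S : ℚ)) ≤ (m : ℚ) * 2 ^ (13 + 9) := by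
  have hsm : (∑ j ∈ Finset.range (9), (Nat.choose (min 13 ((9 + 6) / 2 + 1 - 2)) j : ℚ) / (((j + 1) + 3 * (j + 1).choose 2 + 3 * (j + 1).choose 3 + 2 * (j + 1).choose 4 : ℕ) : ℚ)) = 414767 / 103635 := by
    norm_num [Finset.sum_range_succ, Nat.choose]
  have hsg : (∑ j ∈ Finset.range (9), (Nat.choose (min 19 (5 + 9) - 6) j : ℚ) / (((j + 1) + 3 * (j + 1).choose 2 + 3 * (j + 1).choose 3 + 2 * (j + 1).choose 4 : ℕ) : ℚ)) = 76499569 / 10215450 := by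
    norm_num [Finset.sum_range_succ, Nat.choose]
  have hs4m : (∑ j ∈ Finset.range 6, (Nat.choose (min 5 ((9 + 3) / 2 + 1 - 2)) j : ℚ) / (((j + 1) + 3 * (j + 1).choose 2 + 3 * (j + 1).choose 3 + 2 * (j + 1).choose 4 : ℕ) : ℚ)) = 12767 / 4230 := by
    norm_num [Finset.sum_range_succ, Nat.choose]
  have hs4g : (∑ j ∈ Finset.range 6, (Nat.choose 5 j : ℚ) / (((j + 1) + 3 * (j + 1).choose 2 + 3 * (j + 1).choose 3 + 2 * (j + 1).choose 4 : ℕ) : ℚ)) = 12767 / 4230 := by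
    norm_num [Finset.sum_range_succ, Nat.choose]
  rw [hsm, hsg, hs4m, hs4g]
  norm_num [Nat.choose] at h ⊢
  linarith

/-- **The case `ν = 8` of the coloop-free cell `(13, 9)`**: a set of nullity `8` on `≤ 14` points, by the kit's hitting counts
(`#U ≤ 112970`, `#spanning ≤ 118201`, `m = 98`). -/
theorem c025_thirteen_nine_cf_nu_eight (M : Matroid α) [M.Finite]
    (hR : M.eRank = ((13 : ℕ) : ℕ∞)) (hn : M.E.ncard = 13 + 9)
    (hfree : ∀ e ∈ M.E, ∃ A ⊆ M.E \ {e}, e ∉ M.closure A ∧ e ∉ M.closure ((M.E \ {e}) \ A)) (hK : ∀ e, ¬ M.IsColoop e)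
    (h8 : ∃ W ⊆ M.E, W.ncard ≤ 14 ∧ W.encard = M.eRk W + 8) :
    RLS M 13 5 := by
  classical
  have hd : M.E.encard = M.eRank + ((9 : ℕ) : ℕ∞) := by
    rw [hR, ← M.ground_finite.cast_ncard_eq, hn]
    push_cast
    ring
  obtain ⟨hs3, hs4, hs5⟩ := caps_thirteen_nine_cf M hd hn hfree hK
  obtain ⟨W, hW, hWn, hWk⟩ := h8
  have full : Matroid.topCount M 13 5 ≤ ∑ m ∈ Finset.Icc 5 9, ∑ j ∈ Finset.Icc (m + 8 - 9) m,
      W.ncard.choose j * (13 + 9 - W.ncard).choose (m - j) := by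
    refine (S2.topCount_le_sum_spanning M hR hd 5).trans ?_
    refine Finset.sum_le_sum (fun m _ => ?_)
    have h := S2.ncard_spanning_compl_le_of_nullity M hW hd hWk (m := m)
    rw [hn] at h
    exact h
  have hU' : Matroid.topCount M 13 5 ≤ 112970 := by
    refine full.trans ?_
    generalize W.ncard = w at hWn ⊢
    interval_cases w <;> decide
  have hS' : {X : Set α | X ⊆ M.E ∧ M.eRk X = M.eRank}.ncard ≤ 118201 := by
    refine (S2.ncard_spanning_le_of_nullity M hW hd hWk).trans ?_
    rw [hn]
    generalize W.ncard = w at hWn ⊢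
    interval_cases w <;> decide
  rw [RLS_iff]
  exact c025_core_five_cell_of_topCount_spanning_xqictq5g M 13 9 (by norm_num) hR hn hfree 16 121 842 hs3 hs4 hs5 112970 hU'
    118201 hS' 9480 (by norm_num) (phiK 13 5) (by rw [phiK_thirteen_five]; norm_num)
    ⟨98, by norm_num, by norm_num, tail_thirteen_nine_cf 118201 98 (by norm_num)⟩

end ThmN

end PercRepro
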